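import Summits.CriticalPhenomena.SAWScalingLimit.Theses.SAWRenewalTightness
import Summits.CriticalPhenomena.SAWScalingLimit.Theorems.SAWRenewalTightnessShellCrossingBoundSplit
import Summits.CriticalPhenomena.SAWScalingLimit.Theorems.SAWRenewalTightnessTightOfShellCrossing
import HarnessLib

/-!
# `EventualTight`: the summit-safe decomposition glue
# `ConfinementPositivity → BulkShellTight → EventualTight`

Crux item `stmt-CriticalPhenomena-1372` (`SAWRenewalTightness.EventualTight`, rank 0 of
`route-CriticalPhenomena-SAWRenewalTightness`; the same decl body is the `EventualTight` of eight
sibling routes).  This file is the DECOMPOSITION glue of the crux-strategist of stmt-1372 (D-0019 glued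
split, planner output (b)): it composes two LANDED theorems,

* `Theorems.ShellCrossingBound_of_subs` (p138355, file `SAWRenewalTightnessShellCrossingBoundSplit.lean`):
  `ConfinementPositivity → BulkShellTight → ShellCrossingBound` — the summit-safe split of the sibling
  crux stmt-4728 found by its crux-strategist (good middle circle, socketed enlargement, finite net,
  restriction covariance, union bound), and
* `Theorems.TightOfShellCrossing_proof` (support item stmt-4732, file
  `SAWRenewalTightnessTightOfShellCrossing.lean`): `ShellCrossingBound → EventualTight` — the
  Aizenman–Burchard tightness criterion with a shell-dependent threshold,

into the implication the route-level split `EventualTight ⟸ ConfinementPositivity ∧ BulkShellTight`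
needs (`ledger route edit … --split EventualTight --into … --glue-by Theorems.EventualTight_of_subs`).

The two children, stated verbatim as the hypotheses below (and verbatim the registered stubs
`stub_confinementPositivity` of the lines `Sketch` v5 (stmt-1372) / `confinement-bulk-tightness`
(stmt-4728) and `stub_bulkShellTight` of the latter):

* **Sub₁ `ConfinementPositivity`** (restriction positivity): for nested Dobrushin domains `D' ⊆ D`
  with the same marked points and common sockets `D ∩ (B(a, d) ∪ B(b, d)) ⊆ D'`, the critical SAW of
  `D_δ` from `a_δ` to `b_δ` is a `D'_δ`-walk with probability `≥ c > 0` for all small `δ`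
  (`⟺ liminf_δ Z_{D'}/Z_D > 0`, `Theorems.confinementPositivity_iff_partitionRatio`; a consequence of
  `SAWScalingLimit` together with SLE₈⸝₃ hull-avoidance positivity,
  `Theorems.confinementPositivity_of_scalingLimit`).  An RSW-type LOWER bound; not implied by the crux.
* **Sub₂ `BulkShellTight`** (per-shell tightness of the traversal count on INTERIOR shells, no fixed
  threshold, no rate): for every Dobrushin domain with an endpoint approximation, every shell
  `D(y; η, R)` with `0 < η < R` and `B̄(y, 2R) ⊆ Ω`, and every `ε > 0`, some `j` and `δ₁ > 0` give
  `P_δ[j separate traversals of D(y; η, R)] ≤ ε` for `δ ∈ (0, δ₁]`.  Implied by the crux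
  (`Theorems.EventualTight.Sketch`-side `bulkShellTight_of_eventualTight` in the line file; tree:
  `shellCountTight_iff_eventualTight` restricted to interior shells), hence by the summit.

Neither child is the crux reworded: Sub₂ omits every boundary shell (where the Jordan loop and the
endpoint approximation live — `Theorems/EventualTight/Negative/Snake4Forcing`,
`EndpointLimitsFalse`), Sub₁ is a statement about pairs of domains that tightness alone does not give.
Folklore plane/lattice geometry around the Aizenman–Burchard criterion and the Lawler–Schramm–Werner
restriction covariance of the `x_c`-law; the whole proof is the composition of the two landed theorems.
[cite: AizenmanBurchardDuke1999, Thm 1.1 and §1.b] [cite: LawlerSchrammWerner2004SAW, §3]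
-/

noncomputable section
open MeasureTheory Set Metric Filter Topology
open scoped unitInterval ENNReal
open Literature.Probability.RandomPlanarGeometry Literature.Probability.LatticeModels

namespace Summit.CriticalPhenomena.SAWScalingLimit.Theorems

/-- **The summit-safe decomposition of the crux `EventualTight` (stmt-CriticalPhenomena-1372),
composed:** restriction positivity for nested Dobrushin domains with common marked-point sockets
(`ConfinementPositivity`) and per-shell tightness of the traversal count on interior shells
(`BulkShellTight`) imply eventual tightness of the pushed-forward critical `ℤ²` SAW laws in every
Dobrushin domain with an endpoint approximation — `ShellCrossingBound_of_subs` (boundary shells cost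
nothing beyond restriction positivity) followed by the Aizenman–Burchard criterion
`TightOfShellCrossing_proof`.  The registered stub `EventualTight_of_subs` of stmt-1372, verbatim.
[cite: AizenmanBurchardDuke1999, Thm 1.1] -/
theorem EventualTight_of_subs :
    (∀ (D D' : DobrushinDomain) (a b : ℝ → Site 2) (d : ℝ), 0 < d →
      D'.carrier ⊆ D.carrier → D'.pt 0 = D.pt 0 → D'.pt 1 = D.pt 1 →
      D.carrier ∩ (Metric.ball (D.pt 0) d ∪ Metric.ball (D.pt 1) d) ⊆ D'.carrier →
      SAW.IsEndpointApprox D' a b →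
        ∃ c δ₀ : ℝ, 0 < c ∧ 0 < δ₀ ∧ ∀ δ ∈ Set.Ioc (0 : ℝ) δ₀,
          ENNReal.ofReal c ≤ SAW.law D.carrier δ (a δ) (b δ)
            {γ | ∃ γ' : SAW.DomainSAW D'.carrier δ (a δ) (b δ),
              γ'.walk.support = γ.walk.support}) →
    (∀ (D : DobrushinDomain) (a b : ℝ → Site 2), SAW.IsEndpointApprox D a b →
      ∀ (y : ℂ) (η R : ℝ), 0 < η → η < R → Metric.closedBall y (2 * R) ⊆ D.carrier →
        ∀ ε : ℝ, 0 < ε → ∃ (j : ℕ) (δ₁ : ℝ), 0 < δ₁ ∧ ∀ δ ∈ Set.Ioc (0 : ℝ) δ₁,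
          SAW.law D.carrier δ (a δ) (b δ)
            {γ | (⟨γ.walk.toCurve (meshPoint δ)⟩ : Curve ℂ).HasTraversals j y η R} ≤
            ENNReal.ofReal ε) →
    Summit.CriticalPhenomena.SAWScalingLimit.Theses.SAWRenewalTightness.EventualTight :=
  fun hE hB => TightOfShellCrossing_proof (ShellCrossingBound_of_subs hE hB)

end Summit.CriticalPhenomena.SAWScalingLimit.Theorems
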